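import Mathlib
import Summits.KontsevichZagierPeriods.Zeta5Search.Brown8.RayQSupermult
import Literature.NumberTheory.Irrationality.BrownZudilin2022.GeneralFamily
import HarnessLib

/-!
# ζ(5) search — every Brown–Zudilin ray has a growth RATE: `lim log|Q(n·a)|/n` EXISTS (fam-brown8 g8, part B)

HONEST FRAMING: systematic search; no irrationality claim unless certified. Sizes of the integers `Q` of
[Brown–Zudilin 2022, (17)] (arXiv:2210.03391) along rays of the general family; nothing here bears on `ζ(5)`.

OUR work (Summit side), continuing `Brown8/RayQSupermult`:
* `subadditive_uRay` — `u(n) = log(4(q₁+1)(q₄+1)·n²) − log|Q(n·p;n·q)|` is subadditive; `bddBelow_uRay_div`;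
* **`tendsto_log_absQ_div`** — for `q₁, q₄ ≥ 0` and `Q(p;q) ≠ 0`: `log|Q(n·p;n·q)|/n → rayQRate p q` (Mathlib's Fekete
  lemma `Subadditive.tendsto_lim`);
* **`tendsto_log_abs_QOf_ray`** — for a parameter vector `a` of the general family with `a₁, a₄ ≥ 0` (0-based `a 0`,
  `a 3`; automatic for convergent `a`: `tendsto_log_abs_QOf_ray_of_converges`) and `Q(a) ≠ 0`: `lim log|Q(n·a)|/n`
  exists (`p(n·a) = n·p(a)`, `q(n·a) = n·q(a)` are linear: `pOf_ray`, `qOf_ray`).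
So the `C₁`-type constant of every such ray is a well-defined real number (its value is the supremum of the entropy
function of (17) over the box; pinning it needs a two-sided certificate as certifier 2 did for the record ray).
-/

noncomputable section

open Finset Real Filter Topology

namespace Summit.KontsevichZagierPeriods.Zeta5Search.Brown8

open Summit.KontsevichZagierPeriods.Zeta5Search.BinomialSum
open Literature.NumberTheory.Irrationality.BrownZudilin2022 (zchoose Qcoeff QOf pOf qOf Converges converges_iff_hForm
  hForm hList Fset)

/-! ### Fekete -/

/-- The subadditive sequence of the ray: `u(n) = log(C·n²) − log|Q_n|`, `C = 4(q₁+1)(q₄+1)`, `u(0) = 0`. -/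
def uRay (p : Fin 7 → ℤ) (q : Fin 5 → ℤ) (n : ℕ) : ℝ :=
  if n = 0 then 0 else Real.log (4 * ((q 0 : ℝ) + 1) * ((q 3 : ℝ) + 1) * (n : ℝ) ^ 2) - Real.log (absQ p q n)

/-- `uRay p q n` for `n ≠ 0`. -/
theorem uRay_of_ne_zero (p : Fin 7 → ℤ) (q : Fin 5 → ℤ) {n : ℕ} (hn : n ≠ 0) :
    uRay p q n = Real.log (4 * ((q 0 : ℝ) + 1) * ((q 3 : ℝ) + 1) * (n : ℝ) ^ 2) - Real.log (absQ p q n) := by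
  simp [uRay, hn]

/-- The multiplicative form of subadditivity: for `1 ≤ m ≤ n`,
`|Q_m|·|Q_n|·(C(m+n)²) ≤ |Q_{m+n}|·(Cm²)·(Cn²)`, `C = 4(q₁+1)(q₄+1)`. -/
theorem absQ_mul_le_sq (p : Fin 7 → ℤ) (q : Fin 5 → ℤ) (hq0 : 0 ≤ q 0) (hq3 : 0 ≤ q 3) {m n : ℕ} (hm : 1 ≤ m)
    (hmn : m ≤ n) :
    absQ p q m * absQ p q n * (4 * ((q 0 : ℝ) + 1) * ((q 3 : ℝ) + 1) * ((m : ℝ) + n) ^ 2)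
      ≤ absQ p q (m + n) * (4 * ((q 0 : ℝ) + 1) * ((q 3 : ℝ) + 1) * (m : ℝ) ^ 2)
        * (4 * ((q 0 : ℝ) + 1) * ((q 3 : ℝ) + 1) * (n : ℝ) ^ 2) := by
  have hT := absQ_mul_le p q hq0 hq3 m n
  have hm' : (1 : ℝ) ≤ m := by exact_mod_cast hm
  have hmn' : (m : ℝ) ≤ n := by exact_mod_cast hmn
  have hq0' : (0 : ℝ) ≤ q 0 := by exact_mod_cast hq0
  have hq3' : (0 : ℝ) ≤ q 3 := by exact_mod_cast hq3
  have hQ : 0 ≤ absQ p q (m + n) := absQ_nonneg _ _ _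
  have p1 : ((m : ℝ) * (q 0 : ℝ) + 1) * ((m : ℝ) * (q 3 : ℝ) + 1) ≤ ((q 0 : ℝ) + 1) * ((q 3 : ℝ) + 1) * (m : ℝ) ^ 2 := by
    have a : (m : ℝ) * (q 0 : ℝ) + 1 ≤ ((q 0 : ℝ) + 1) * m := by nlinarith
    have b : (m : ℝ) * (q 3 : ℝ) + 1 ≤ ((q 3 : ℝ) + 1) * m := by nlinarith
    calc ((m : ℝ) * (q 0 : ℝ) + 1) * ((m : ℝ) * (q 3 : ℝ) + 1) ≤ (((q 0 : ℝ) + 1) * m) * (((q 3 : ℝ) + 1) * m) :=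
          mul_le_mul a b (by positivity) (by positivity)
      _ = ((q 0 : ℝ) + 1) * ((q 3 : ℝ) + 1) * (m : ℝ) ^ 2 := by ring
  have p2 : ((m : ℝ) + n) ^ 2 ≤ 4 * (n : ℝ) ^ 2 := by nlinarith
  have A : ((m : ℝ) * (q 0 : ℝ) + 1) * ((m : ℝ) * (q 3 : ℝ) + 1) * ((m : ℝ) + n) ^ 2
      ≤ ((q 0 : ℝ) + 1) * ((q 3 : ℝ) + 1) * (m : ℝ) ^ 2 * (4 * (n : ℝ) ^ 2) :=
    mul_le_mul p1 p2 (by positivity) (by positivity)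
  set C : ℝ := 4 * ((q 0 : ℝ) + 1) * ((q 3 : ℝ) + 1) with hC
  have hCpos : 0 < C := by rw [hC]; positivity
  calc absQ p q m * absQ p q n * (C * ((m : ℝ) + n) ^ 2)
      = (absQ p q m * absQ p q n) * ((m : ℝ) + n) ^ 2 * C := by ring
    _ ≤ (((m : ℝ) * (q 0 : ℝ) + 1) * ((m : ℝ) * (q 3 : ℝ) + 1) * absQ p q (m + n)) * ((m : ℝ) + n) ^ 2 * C := by
        gcongr
    _ = absQ p q (m + n) * (((m : ℝ) * (q 0 : ℝ) + 1) * ((m : ℝ) * (q 3 : ℝ) + 1) * ((m : ℝ) + n) ^ 2) * C := by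
        ring
    _ ≤ absQ p q (m + n) * (((q 0 : ℝ) + 1) * ((q 3 : ℝ) + 1) * (m : ℝ) ^ 2 * (4 * (n : ℝ) ^ 2)) * C := by gcongr
    _ = absQ p q (m + n) * (C * (m : ℝ) ^ 2) * (C * (n : ℝ) ^ 2) := by rw [hC]; ring

/-- Subadditivity for `1 ≤ m ≤ n`. -/
private theorem uRay_add_le_of_le (p : Fin 7 → ℤ) (q : Fin 5 → ℤ) (hq0 : 0 ≤ q 0) (hq3 : 0 ≤ q 3)
    (hQ : Qcoeff p q ≠ 0) {m n : ℕ} (hm : 1 ≤ m) (hmn : m ≤ n) :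
    uRay p q (m + n) ≤ uRay p q m + uRay p q n := by
  have hn : 1 ≤ n := hm.trans hmn
  rw [uRay_of_ne_zero p q (show m + n ≠ 0 by omega), uRay_of_ne_zero p q (show m ≠ 0 by omega),
    uRay_of_ne_zero p q (show n ≠ 0 by omega)]
  have qm := absQ_pos p q hq0 hq3 hQ m hm
  have qn := absQ_pos p q hq0 hq3 hQ n hn
  have qmn := absQ_pos p q hq0 hq3 hQ (m + n) (by omega)
  have hm' : (0 : ℝ) < m := by exact_mod_cast hm
  have hn' : (0 : ℝ) < n := by exact_mod_cast hn
  have hq0' : (0 : ℝ) ≤ q 0 := by exact_mod_cast hq0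
  have hq3' : (0 : ℝ) ≤ q 3 := by exact_mod_cast hq3
  have hC : (0 : ℝ) < 4 * ((q 0 : ℝ) + 1) * ((q 3 : ℝ) + 1) := by positivity
  have key := Real.log_le_log (by positivity) (absQ_mul_le_sq p q hq0 hq3 hm hmn)
  have e1 : Real.log (absQ p q m * absQ p q n * (4 * ((q 0 : ℝ) + 1) * ((q 3 : ℝ) + 1) * ((m : ℝ) + n) ^ 2))
      = Real.log (absQ p q m) + Real.log (absQ p q n)
        + Real.log (4 * ((q 0 : ℝ) + 1) * ((q 3 : ℝ) + 1) * ((m : ℝ) + n) ^ 2) := by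
    rw [Real.log_mul (by positivity) (by positivity), Real.log_mul (by positivity) (by positivity)]
  have e2 : Real.log (absQ p q (m + n) * (4 * ((q 0 : ℝ) + 1) * ((q 3 : ℝ) + 1) * (m : ℝ) ^ 2)
      * (4 * ((q 0 : ℝ) + 1) * ((q 3 : ℝ) + 1) * (n : ℝ) ^ 2))
      = Real.log (absQ p q (m + n)) + Real.log (4 * ((q 0 : ℝ) + 1) * ((q 3 : ℝ) + 1) * (m : ℝ) ^ 2)
        + Real.log (4 * ((q 0 : ℝ) + 1) * ((q 3 : ℝ) + 1) * (n : ℝ) ^ 2) := by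
    rw [Real.log_mul (by positivity) (by positivity), Real.log_mul (by positivity) (by positivity)]
  rw [e1, e2] at key
  push_cast
  linarith

/-- **`uRay p q` is subadditive** (for `q₁, q₄ ≥ 0`, `Q(p;q) ≠ 0`). -/
theorem subadditive_uRay (p : Fin 7 → ℤ) (q : Fin 5 → ℤ) (hq0 : 0 ≤ q 0) (hq3 : 0 ≤ q 3) (hQ : Qcoeff p q ≠ 0) :
    Subadditive (uRay p q) := by
  intro m n
  rcases Nat.eq_zero_or_pos m with hm | hm
  · subst hm; simp [uRay]
  rcases Nat.eq_zero_or_pos n with hn | hn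
  · subst hn; simp [uRay]
  rcases le_total m n with hmn | hnm
  · exact uRay_add_le_of_le p q hq0 hq3 hQ hm hmn
  · rw [add_comm m n, add_comm (uRay p q m)]
    exact uRay_add_le_of_le p q hq0 hq3 hQ hn hnm

/-- `uRay p q n / n` is bounded below. -/
theorem bddBelow_uRay_div (p : Fin 7 → ℤ) (q : Fin 5 → ℤ) (hq0 : 0 ≤ q 0) (hq3 : 0 ≤ q 3) (hQ : Qcoeff p q ≠ 0) :
    BddBelow (Set.range fun n : ℕ => uRay p q n / n) := by
  refine ⟨min 0 (-crudeK p q), ?_⟩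
  rintro _ ⟨n, rfl⟩
  dsimp only
  rcases Nat.eq_zero_or_pos n with hn | hn
  · subst hn; simp [uRay]
  have hn' : (0 : ℝ) < n := by exact_mod_cast hn
  have hq0' : (0 : ℝ) ≤ q 0 := by exact_mod_cast hq0
  have hq3' : (0 : ℝ) ≤ q 3 := by exact_mod_cast hq3
  have h1 : (1 : ℝ) ≤ 4 * ((q 0 : ℝ) + 1) * ((q 3 : ℝ) + 1) * (n : ℝ) ^ 2 := by
    have : (1 : ℝ) ≤ n := by exact_mod_cast hn
    have h4 : (1 : ℝ) ≤ 4 * ((q 0 : ℝ) + 1) * ((q 3 : ℝ) + 1) := by nlinarith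
    nlinarith
  have hlog : 0 ≤ Real.log (4 * ((q 0 : ℝ) + 1) * ((q 3 : ℝ) + 1) * (n : ℝ) ^ 2) := Real.log_nonneg h1
  have hQ' := log_absQ_le p q hq0 hq3 hn (absQ_pos p q hq0 hq3 hQ n hn)
  refine (min_le_right _ _).trans ?_
  rw [uRay_of_ne_zero p q hn.ne', le_div_iff₀ hn']
  linarith

/-- **The rate of the ray**: `rayQRate p q = lim log|Q(n·p;n·q)|/n` (through Fekete's limit). -/
def rayQRate (p : Fin 7 → ℤ) (q : Fin 5 → ℤ) (hq0 : 0 ≤ q 0) (hq3 : 0 ≤ q 3) (hQ : Qcoeff p q ≠ 0) : ℝ :=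
  -(subadditive_uRay p q hq0 hq3 hQ).lim

/-- `log(C·n²)/n → 0` for `C > 0`. -/
private theorem tendsto_log_const_sq_div {C : ℝ} (hC : 0 < C) :
    Tendsto (fun n : ℕ => Real.log (C * (n : ℝ) ^ 2) / n) atTop (𝓝 0) := by
  have h1 : Tendsto (fun n : ℕ => Real.log (n : ℝ) / (n : ℝ)) atTop (𝓝 0) :=
    (Real.isLittleO_log_id_atTop.tendsto_div_nhds_zero).comp tendsto_natCast_atTop_atTop
  have h2 : Tendsto (fun n : ℕ => Real.log C / (n : ℝ)) atTop (𝓝 0) := tendsto_const_div_atTop_nhds_zero_nat _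
  have h := h2.add (h1.const_mul 2)
  rw [zero_add, mul_zero] at h
  refine h.congr' ?_
  filter_upwards [eventually_ge_atTop 1] with n hn
  have hn' : (0 : ℝ) < n := by exact_mod_cast hn
  rw [Real.log_mul hC.ne' (by positivity), Real.log_pow]
  push_cast
  field_simp

/-- **THE LIMIT EXISTS on every ray**: for `q₁, q₄ ≥ 0` and `Q(p;q) ≠ 0`,
`log|Q(n·p;n·q)|/n → rayQRate p q`. -/
theorem tendsto_log_absQ_div (p : Fin 7 → ℤ) (q : Fin 5 → ℤ) (hq0 : 0 ≤ q 0) (hq3 : 0 ≤ q 3)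
    (hQ : Qcoeff p q ≠ 0) :
    Tendsto (fun n : ℕ => Real.log (absQ p q n) / n) atTop (𝓝 (rayQRate p q hq0 hq3 hQ)) := by
  have hq0' : (0 : ℝ) ≤ q 0 := by exact_mod_cast hq0
  have hq3' : (0 : ℝ) ≤ q 3 := by exact_mod_cast hq3
  have hF := (subadditive_uRay p q hq0 hq3 hQ).tendsto_lim (bddBelow_uRay_div p q hq0 hq3 hQ)
  have h := (tendsto_log_const_sq_div (show (0 : ℝ) < 4 * ((q 0 : ℝ) + 1) * ((q 3 : ℝ) + 1) by positivity)).sub hF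
  rw [zero_sub] at h
  refine h.congr' ?_
  filter_upwards [eventually_ge_atTop 1] with n hn
  rw [uRay_of_ne_zero p q (by omega)]
  ring

/-! ### Rays of the general family -/

/-- `p(n·a) = n·p(a)` (the forms (11) are linear). -/
theorem pOf_ray (a : Fin 8 → ℤ) (n : ℕ) : pOf (ray a n) = ray (pOf a) n := by
  ext i; fin_cases i <;> (simp [pOf, ray]; try ring)

/-- `q(n·a) = n·q(a)`. -/
theorem qOf_ray (a : Fin 8 → ℤ) (n : ℕ) : qOf (ray a n) = ray (qOf a) n := by
  ext i; fin_cases i <;> (simp [qOf, ray]; try ring)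

/-- **On every ray of the general family the limit `lim log|Q(n·a)|/n` exists** (for `a₄ = q₁ ≥ 0`, `a₁ = q₄ ≥ 0` in the
tree's 0-based indexing `a 3`, `a 0`, and `Q(a) ≠ 0`). -/
theorem tendsto_log_abs_QOf_ray (a : Fin 8 → ℤ) (h3 : 0 ≤ a 3) (h0 : 0 ≤ a 0) (hQ : QOf a ≠ 0) :
    ∃ c : ℝ, Tendsto (fun n : ℕ => Real.log |(QOf (fun i => (n : ℤ) * a i) : ℝ)| / n) atTop (𝓝 c) := by
  have hq0 : 0 ≤ qOf a 0 := by simpa [qOf] using h3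
  have hq3 : 0 ≤ qOf a 3 := by simpa [qOf] using h0
  have hQ' : Qcoeff (pOf a) (qOf a) ≠ 0 := hQ
  refine ⟨rayQRate (pOf a) (qOf a) hq0 hq3 hQ', (tendsto_log_absQ_div (pOf a) (qOf a) hq0 hq3 hQ').congr fun n => ?_⟩
  show Real.log (absQ (pOf a) (qOf a) n) / n = Real.log |(QOf (ray a n) : ℝ)| / n
  rw [absQ, QOf, pOf_ray, qOf_ray]

/-- The same for a CONVERGENT parameter vector (`Converges a` forces every `a_i ≥ 0`). -/
theorem tendsto_log_abs_QOf_ray_of_converges (a : Fin 8 → ℤ) (ha : Converges a) (hQ : QOf a ≠ 0) :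
    ∃ c : ℝ, Tendsto (fun n : ℕ => Real.log |(QOf (fun i => (n : ℤ) * a i) : ℝ)| / n) atTop (𝓝 c) := by
  rw [converges_iff_hForm] at ha
  have h0 : 0 ≤ a 0 := by simpa [hForm, hList] using ha 1 (by simp [Fset])
  have h3 : 0 ≤ a 3 := by simpa [hForm, hList] using ha 4 (by simp [Fset])
  exact tendsto_log_abs_QOf_ray a h3 h0 hQ

end Summit.KontsevichZagierPeriods.Zeta5Search.Brown8
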